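import Literature.NumberTheory.Sieve.HeathBrownWeightFourthMoment
import Literature.NumberTheory.Sieve.HeathBrownMorozResidueClasses
import HarnessLib

/-!
# The mass of the Heath-Brown weight from the prime-pair asymptotic, PROVED

Topic `Literature/NumberTheory/Sieve`, namespace `Literature.NumberTheory.Sieve.CubicMinorant`
(continuation of `CubicMinorantDefs.lean`, `HeathBrownWeightFourthMoment.lean`,
`HeathBrownMorozResidueClasses.lean`).

The weight `f₃(n) = N^{1/3} log n · #{(x,y) ∈ primePairs X η : x³ + 2y³ = n}` of the parity-ideate
cubic-minorant programme has mass `U = ∑_{n ≤ N} f₃(n) = N^{1/3} ∑_{(x,y)} log(x³+2y³) ≥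
N^{1/3} · 3 log X · π(𝒜)(X, η)`, every prime value lying in `(N/2, N]` once `(1+η)³ ≤ 2`
(`sum_hbRep_eq_primePairCount`, `sum_hbWeight_ge`).  Consequently Heath-Brown's asymptotic
`π(𝒜)(X, (log X)^{−c}) = σ₀ η²X²/(3 log X) · (1 + o(1))` [HeathBrownActa2001, Theorem 1] — in the
tree the `d = 1` case of the class asymptotic of [HeathBrownMoroz2004, Thm 2]
(`residueClassPrimeCount_one_zero_zero`, `classWeight_one`) — yields
`U ≥ (σ₀ 6^{−2/3}/2) η² N` for `N ≥ N₀` (`hbWeight_mass_lower`): conjunct (i) of the parity-ideate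
route `GoldbachHeathBrownDispersion`'s support item «ClassTransfer», from its class hypothesis at
`d = 1` (so for every `Q ≥ 1`).  No new facts.  Written for the parity-ideate cell (literature seat
g14, 2026-08-27).

## References

* [HeathBrownActa2001] D. R. Heath-Brown, *Primes represented by x³ + 2y³*, Acta Math. 186 (2001),
  Theorem 1 and §2 (2.2).
* [HeathBrownMoroz2004] D. R. Heath-Brown, B. Z. Moroz, Proc. LMS (3) 88 (2004), Thm 2.
-/

noncomputable section

open Finset Filter Topology Asymptotics
open Literature.NumberTheory.Sieve Literature.NumberTheory.Sieve.CubicPrimes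

namespace Literature.NumberTheory.Sieve.CubicMinorant

/-- **Every prime value of the box lies in `(N/2, N]`**: for `(x, y) ∈ primePairs X η` with
`X = (N/6)^{1/3}`, `X³ < x³ + 2y³` and, if `(1+η)³ ≤ 2`, `x³ + 2y³ ≤ N`.
[cite: HeathBrownActa2001, §2 (2.2) (the box X < x, y ≤ X(1+η))] -/
theorem primePairs_value_bounds {c : ℝ} {N : ℕ} {x y : ℕ}
    (hxy : (x, y) ∈ primePairs (hbX N) (hbEta c N)) :
    hbX N ^ 3 < ((x ^ 3 + 2 * y ^ 3 : ℕ) : ℝ) ∧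
      ((1 + hbEta c N) ^ 3 ≤ 2 → 0 ≤ hbEta c N → x ^ 3 + 2 * y ^ 3 ≤ N) := by
  obtain ⟨hx1, hx2, hy1, hy2, -, -⟩ := mem_primePairs_iff.mp hxy
  have hX := hbX_nonneg N
  have hX3 : hbX N ^ 3 = (N : ℝ) / 6 := hbX_pow_three N
  have hx0 : (0 : ℝ) ≤ x := Nat.cast_nonneg x
  have hy0 : (0 : ℝ) ≤ y := Nat.cast_nonneg y
  have hx3 : hbX N ^ 3 < (x : ℝ) ^ 3 := by
    have := pow_lt_pow_left₀ hx1 hX three_ne_zero; exact this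
  have hy3 : hbX N ^ 3 < (y : ℝ) ^ 3 := pow_lt_pow_left₀ hy1 hX three_ne_zero
  refine ⟨?_, fun h2 hη => ?_⟩
  · push_cast; nlinarith [pow_nonneg hX 3]
  · have hY : 0 ≤ hbX N * (1 + hbEta c N) := by positivity
    have hx3' : (x : ℝ) ^ 3 ≤ (hbX N * (1 + hbEta c N)) ^ 3 := pow_le_pow_left₀ hx0 hx2 3
    have hy3' : (y : ℝ) ^ 3 ≤ (hbX N * (1 + hbEta c N)) ^ 3 := pow_le_pow_left₀ hy0 hy2 3
    have hv : ((x ^ 3 + 2 * y ^ 3 : ℕ) : ℝ) ≤ 3 * (hbX N * (1 + hbEta c N)) ^ 3 := by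
      push_cast; linarith
    have h3 : 3 * (hbX N * (1 + hbEta c N)) ^ 3 ≤ N := by
      rw [mul_pow, hX3]
      have hN : (0 : ℝ) ≤ N := Nat.cast_nonneg N
      nlinarith
    exact_mod_cast hv.trans h3

/-- **`∑_n #{pairs with value n} = π(𝒜)`**: once `(1+η)³ ≤ 2` (all prime values `≤ N`),
`∑_{n ∈ [1,N]} hbRep c N n = primePairCount (hbX N) (hbEta c N)`.
[cite: HeathBrownActa2001, §2 (2.2) (the box X < x, y ≤ X(1+η))] -/
theorem sum_hbRep_eq_primePairCount {c : ℝ} {N : ℕ} (h2 : (1 + hbEta c N) ^ 3 ≤ 2)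
    (hη : 0 ≤ hbEta c N) :
    ∑ n ∈ Icc 1 N, hbRep c N n = primePairCount (hbX N) (hbEta c N) := by
  rw [primePairCount_def]
  symm
  refine card_eq_sum_card_fiberwise fun xy hxy => ?_
  obtain ⟨x, y⟩ := xy
  have hxy' : (x, y) ∈ primePairs (hbX N) (hbEta c N) := by simpa using hxy
  obtain ⟨hlow, hup⟩ := primePairs_value_bounds hxy'
  simp only [Finset.mem_coe, mem_Icc]
  refine ⟨?_, hup h2 hη⟩
  have : (0 : ℝ) < ((x ^ 3 + 2 * y ^ 3 : ℕ) : ℝ) := lt_of_le_of_lt (pow_nonneg (hbX_nonneg N) 3) hlow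
  exact_mod_cast this

/-- **The mass dominates `N^{1/3} · 3 log X · π(𝒜)`**: every counted `n = x³ + 2y³` exceeds `X³`, so
`log n ≥ 3 log X`; hence `∑_n f₃(n) ≥ N^{1/3} (3 log X) ∑_n hbRep(n)` (for `X ≥ 1`).
[cite: HeathBrownActa2001, Theorem 1 (the weight counts prime values x³+2y³ > X³)] -/
theorem sum_hbWeight_ge {c : ℝ} {N : ℕ} (hX1 : 1 ≤ hbX N) :
    (N : ℝ) ^ ((1 : ℝ) / 3) * (3 * Real.log (hbX N)) * ∑ n ∈ Icc 1 N, (hbRep c N n : ℝ) ≤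
      ∑ n ∈ Icc 1 N, hbWeight c N n := by
  rw [mul_sum]
  refine sum_le_sum fun n _ => ?_
  unfold hbWeight
  rcases Nat.eq_zero_or_pos (hbRep c N n) with h0 | hpos
  · rw [h0]; simp
  · -- a representing pair exists, so `n > X³`
    obtain ⟨xy, hxy⟩ := card_pos.mp hpos
    obtain ⟨x, y⟩ := xy
    rw [mem_filter] at hxy
    obtain ⟨hmem, hval⟩ := hxy
    have hlow := (primePairs_value_bounds hmem).1
    rw [hval] at hlow
    have hX0 : 0 < hbX N := lt_of_lt_of_le one_pos hX1
    have hlog : 3 * Real.log (hbX N) ≤ Real.log n := by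
      have e : Real.log (hbX N ^ 3) = 3 * Real.log (hbX N) := by
        rw [Real.log_pow]; norm_num
      rw [← e]
      exact Real.log_le_log (pow_pos hX0 3) hlow.le
    have hN0 : (0 : ℝ) ≤ (N : ℝ) ^ ((1 : ℝ) / 3) := Real.rpow_nonneg (Nat.cast_nonneg N) _
    have hr0 : (0 : ℝ) ≤ hbRep c N n := Nat.cast_nonneg _
    calc (N : ℝ) ^ ((1 : ℝ) / 3) * (3 * Real.log (hbX N)) * (hbRep c N n : ℝ)
        = (N : ℝ) ^ ((1 : ℝ) / 3) * (hbRep c N n : ℝ) * (3 * Real.log (hbX N)) := by ring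
      _ ≤ (N : ℝ) ^ ((1 : ℝ) / 3) * (hbRep c N n : ℝ) * Real.log n :=
          mul_le_mul_of_nonneg_left hlog (mul_nonneg hN0 hr0)
      _ = (N : ℝ) ^ ((1 : ℝ) / 3) * Real.log n * (hbRep c N n : ℝ) := by ring

/-- `N^{1/3} X² = 6^{−2/3} N` for `X = (N/6)^{1/3}`. [cite: HeathBrownActa2001, Theorem 1 (X³ = N/6)] -/
theorem rpow_third_mul_hbX_sq (N : ℕ) :
    (N : ℝ) ^ ((1 : ℝ) / 3) * hbX N ^ 2 = (6 : ℝ) ^ (-(2 / 3 : ℝ)) * N := by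
  have hN : (0 : ℝ) ≤ N := Nat.cast_nonneg N
  unfold hbX
  rw [Real.div_rpow hN (by norm_num), div_pow, ← Real.rpow_natCast ((N : ℝ) ^ ((1 : ℝ) / 3)),
    ← Real.rpow_mul hN, ← Real.rpow_natCast ((6 : ℝ) ^ ((1 : ℝ) / 3)), ← Real.rpow_mul (by norm_num),
    Real.rpow_neg (by norm_num)]
  have h : (N : ℝ) ^ ((1 : ℝ) / 3) * (N : ℝ) ^ ((1 : ℝ) / 3 * ((2 : ℕ) : ℝ)) = N := by
    rw [← Real.rpow_add' hN (by norm_num)]; norm_num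
  rw [mul_div_assoc', h]
  norm_num
  ring

/-- **The mass of the Heath-Brown weight** (conjunct (i) of the parity-ideate route
`GoldbachHeathBrownDispersion`'s item «ClassTransfer», from its class hypothesis at `d = 1`):
if `π(𝒜)(X, (log X)^{−c}) − w(1)·M(X) = o(M(X))` with `M = mainTerm c σ₀`, `σ₀ > 0`, then
`∑_{n ≤ N} f₃(n) ≥ (σ₀ 6^{−2/3}/2) η² N` for all large `N`.
[cite: HeathBrownActa2001, Theorem 1 (π(𝒜) = σ₀ η²X²/(3 log X)(1 + o(1)))] -/
theorem hbWeight_mass_lower {c σ₀ : ℝ} (hc : 0 < c) (hσ : 0 < σ₀)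
    (h1 : IsLittleO atTop
      (fun X : ℝ => (residueClassPrimeCount X (Real.log X ^ (-c)) 1 0 0 : ℝ) -
        classWeight 1 * mainTerm c σ₀ X)
      (fun X : ℝ => mainTerm c σ₀ X)) :
    ∃ N₀ : ℕ, ∀ N : ℕ, N₀ ≤ N →
      σ₀ * (6 : ℝ) ^ (-(2 / 3 : ℝ)) / 2 * hbEta c N ^ 2 * N ≤ ∑ k ∈ Icc 1 N, hbWeight c N k := by
  -- `|π(𝒜) − M| ≤ M/2` eventually in `X`, pulled back along `X = hbX N`
  have hev := h1.def (show (0 : ℝ) < 1 / 2 by norm_num)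
  have e1 := tendsto_hbX.eventually hev
  have e2 := tendsto_hbX.eventually_gt_atTop (1 : ℝ)
  have e3 := (tendsto_hbEta hc).eventually (eventually_le_nhds (show (0 : ℝ) < 1 / 4 by norm_num))
  obtain ⟨N₀, hN₀⟩ := eventually_atTop.mp (e1.and (e2.and e3))
  refine ⟨N₀, fun N hN => ?_⟩
  obtain ⟨hclose, hX1, hη4⟩ := hN₀ N hN
  set X := hbX N with hXdef
  set η := hbEta c N with hηdef
  have hX0 : 0 < X := by linarith
  have hlogX : 0 < Real.log X := Real.log_pos hX1
  have hη0 : 0 ≤ η := by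
    rw [hηdef]; unfold hbEta; exact Real.rpow_nonneg hlogX.le _
  have hη2 : (1 + η) ^ 3 ≤ 2 := by
    calc (1 + η) ^ 3 ≤ (1 + 1 / 4) ^ 3 := pow_le_pow_left₀ (by linarith) (by linarith) 3
      _ ≤ 2 := by norm_num
  have hMT : 0 < mainTerm c σ₀ X := mainTerm_pos hσ hX1
  -- the count is at least `M/2`
  rw [classWeight_one, one_mul, Real.norm_eq_abs, Real.norm_eq_abs, abs_of_pos hMT] at hclose
  have hcount : mainTerm c σ₀ X / 2 ≤ (primePairCount X η : ℝ) := by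
    rw [hηdef, hbEta, ← hXdef, ← residueClassPrimeCount_one_zero_zero]
    have := (abs_le.mp hclose).1
    linarith
  -- `U ≥ N^{1/3} · 3 log X · π(𝒜) ≥ N^{1/3} · 3 log X · M/2 = (σ₀ 6^{-2/3}/2) η² N`
  have hsum : (∑ n ∈ Icc 1 N, (hbRep c N n : ℝ)) = primePairCount X η := by
    rw [← Nat.cast_sum, sum_hbRep_eq_primePairCount hη2 hη0]
  have hge := sum_hbWeight_ge (c := c) hX1.le
  rw [hsum] at hge
  refine le_trans ?_ hge
  have hN0 : (0 : ℝ) ≤ (N : ℝ) ^ ((1 : ℝ) / 3) := Real.rpow_nonneg (Nat.cast_nonneg N) _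
  have hη' : Real.log X ^ (-c) = η := by rw [hηdef, hbEta, ← hXdef]
  have h6 := rpow_third_mul_hbX_sq N
  rw [← hXdef] at h6
  have hcancel : (3 * Real.log X) * (σ₀ * η ^ 2 * X ^ 2 / (3 * Real.log X) / 2) =
      σ₀ * η ^ 2 * X ^ 2 / 2 := by
    field_simp
  calc σ₀ * (6 : ℝ) ^ (-(2 / 3 : ℝ)) / 2 * η ^ 2 * N
      = (N : ℝ) ^ ((1 : ℝ) / 3) * (3 * Real.log X) * (mainTerm c σ₀ X / 2) := by
        rw [mainTerm_def, hη']
        calc σ₀ * (6 : ℝ) ^ (-(2 / 3 : ℝ)) / 2 * η ^ 2 * N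
            = σ₀ / 2 * η ^ 2 * ((6 : ℝ) ^ (-(2 / 3 : ℝ)) * N) := by ring
          _ = σ₀ / 2 * η ^ 2 * ((N : ℝ) ^ ((1 : ℝ) / 3) * X ^ 2) := by rw [h6]
          _ = (N : ℝ) ^ ((1 : ℝ) / 3) * ((3 * Real.log X) *
              (σ₀ * η ^ 2 * X ^ 2 / (3 * Real.log X) / 2)) := by rw [hcancel]; ring
          _ = (N : ℝ) ^ ((1 : ℝ) / 3) * (3 * Real.log X) *
              (σ₀ * η ^ 2 * X ^ 2 / (3 * Real.log X) / 2) := by ring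
    _ ≤ (N : ℝ) ^ ((1 : ℝ) / 3) * (3 * Real.log X) * (primePairCount X η : ℝ) :=
        mul_le_mul_of_nonneg_left hcount (mul_nonneg hN0 (by positivity))

/-- **Conjunct (i) of «ClassTransfer» for every `Q ≥ 1`**: the finite-uniform class asymptotics at
`(Q, c, σ₀)` (used only at `d = 1`, `(a, b) = (0, 0)`) give `U ≥ (σ₀ 6^{−2/3}/2) η² N` for `N ≥ N₀`.
[cite: HeathBrownActa2001, Theorem 1 (π(𝒜) = σ₀ η²X²/(3 log X)(1 + o(1)))] -/
theorem hbWeight_mass_lower_of_classAsymptotic (Q : ℕ) (hQ : 1 ≤ Q) {c σ₀ : ℝ} (hc : 0 < c)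
    (hσ : 0 < σ₀)
    (h : ∀ d a b : ℕ, 0 < d → d ≤ Q → Nat.Coprime (a ^ 3 + 2 * b ^ 3) d →
      IsLittleO atTop
        (fun X : ℝ => (residueClassPrimeCount X (Real.log X ^ (-c)) d a b : ℝ) -
          classWeight d * mainTerm c σ₀ X)
        (fun X : ℝ => mainTerm c σ₀ X)) :
    ∃ N₀ : ℕ, ∀ N : ℕ, N₀ ≤ N →
      σ₀ * (6 : ℝ) ^ (-(2 / 3 : ℝ)) / 2 * hbEta c N ^ 2 * N ≤ ∑ k ∈ Icc 1 N, hbWeight c N k :=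
  hbWeight_mass_lower hc hσ (h 1 0 0 one_pos hQ (Nat.coprime_one_right _))

/-! ### Class sums: the two-sided comparison with prime-pair counts, and the class decomposition -/

/-- Termwise: `f₃(n) ≥ N^{1/3} · 3 log X · hbRep(n)` for `X ≥ 1` (a represented `n` exceeds `X³`).
[cite: HeathBrownActa2001, Theorem 1 (the weight counts prime values x³+2y³ > X³)] -/
theorem hbWeight_ge_mul_hbRep {c : ℝ} {N : ℕ} (hX1 : 1 ≤ hbX N) (n : ℕ) :
    (N : ℝ) ^ ((1 : ℝ) / 3) * (3 * Real.log (hbX N)) * (hbRep c N n : ℝ) ≤ hbWeight c N n := by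
  unfold hbWeight
  rcases Nat.eq_zero_or_pos (hbRep c N n) with h0 | hpos
  · rw [h0]; simp
  · obtain ⟨xy, hxy⟩ := card_pos.mp hpos
    obtain ⟨x, y⟩ := xy
    rw [mem_filter] at hxy
    obtain ⟨hmem, hval⟩ := hxy
    have hlow := (primePairs_value_bounds hmem).1
    rw [hval] at hlow
    have hX0 : 0 < hbX N := lt_of_lt_of_le one_pos hX1
    have hlog : 3 * Real.log (hbX N) ≤ Real.log n := by
      have e : Real.log (hbX N ^ 3) = 3 * Real.log (hbX N) := by
        rw [Real.log_pow]; norm_num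
      rw [← e]
      exact Real.log_le_log (pow_pos hX0 3) hlow.le
    have hN0 : (0 : ℝ) ≤ (N : ℝ) ^ ((1 : ℝ) / 3) := Real.rpow_nonneg (Nat.cast_nonneg N) _
    have hr0 : (0 : ℝ) ≤ hbRep c N n := Nat.cast_nonneg _
    calc (N : ℝ) ^ ((1 : ℝ) / 3) * (3 * Real.log (hbX N)) * (hbRep c N n : ℝ)
        = (N : ℝ) ^ ((1 : ℝ) / 3) * (hbRep c N n : ℝ) * (3 * Real.log (hbX N)) := by ring
      _ ≤ (N : ℝ) ^ ((1 : ℝ) / 3) * (hbRep c N n : ℝ) * Real.log n :=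
          mul_le_mul_of_nonneg_left hlog (mul_nonneg hN0 hr0)
      _ = (N : ℝ) ^ ((1 : ℝ) / 3) * Real.log n * (hbRep c N n : ℝ) := by ring

/-- **Class sums of `f₃` from below**: once `(1+η)³ ≤ 2` and `X ≥ 1`,
`∑_{k ≤ N, k ≡ r (d)} f₃(k) ≥ N^{1/3} · 3 log X · #{(x, y) ∈ primePairs : x³ + 2y³ ≡ r (mod d)}`
(companion of `sum_hbWeight_modEq_le_card`, whose factor is `N^{1/3} log N`).
[cite: HeathBrownMoroz2004, §3 (3.1)] -/
theorem sum_hbWeight_modEq_ge_card {c : ℝ} {N : ℕ} (hX1 : 1 ≤ hbX N)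
    (h2 : (1 + hbEta c N) ^ 3 ≤ 2) (hη : 0 ≤ hbEta c N) (d r : ℕ) :
    (N : ℝ) ^ ((1 : ℝ) / 3) * (3 * Real.log (hbX N)) *
        #{xy ∈ primePairs (hbX N) (hbEta c N) | xy.1 ^ 3 + 2 * xy.2 ^ 3 ≡ r [MOD d]} ≤
      ∑ k ∈ (Icc 1 N).filter (fun k : ℕ => k ≡ r [MOD d]), hbWeight c N k := by
  set T := (Icc 1 N).filter (fun k : ℕ => k ≡ r [MOD d]) with hT
  have step : ∑ k ∈ T, (N : ℝ) ^ ((1 : ℝ) / 3) * (3 * Real.log (hbX N)) * (hbRep c N k : ℝ) ≤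
      ∑ k ∈ T, hbWeight c N k := sum_le_sum fun k _ => hbWeight_ge_mul_hbRep hX1 k
  refine le_trans ?_ step
  rw [← mul_sum]
  have hfib : ∑ k ∈ T, (hbRep c N k : ℝ) =
      #{xy ∈ primePairs (hbX N) (hbEta c N) | xy.1 ^ 3 + 2 * xy.2 ^ 3 ∈ T} := by
    rw [← Nat.cast_sum, Nat.cast_inj]
    exact sum_card_fiberwise_eq_card_filter _ _ _
  rw [hfib]
  have hcard : #{xy ∈ primePairs (hbX N) (hbEta c N) | xy.1 ^ 3 + 2 * xy.2 ^ 3 ≡ r [MOD d]} ≤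
      #{xy ∈ primePairs (hbX N) (hbEta c N) | xy.1 ^ 3 + 2 * xy.2 ^ 3 ∈ T} := by
    refine card_le_card fun xy hxy => ?_
    obtain ⟨x, y⟩ := xy
    rw [mem_filter] at hxy ⊢
    refine ⟨hxy.1, ?_⟩
    rw [hT, mem_filter, mem_Icc]
    obtain ⟨hlow, hup⟩ := primePairs_value_bounds hxy.1
    have h1 : (0 : ℝ) < ((x ^ 3 + 2 * y ^ 3 : ℕ) : ℝ) :=
      lt_of_le_of_lt (pow_nonneg (hbX_nonneg N) 3) hlow
    exact ⟨⟨by exact_mod_cast h1, hup h2 hη⟩, hxy.2⟩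
  have hX0 : 0 ≤ Real.log (hbX N) := Real.log_nonneg hX1
  have hN0 : (0 : ℝ) ≤ (N : ℝ) ^ ((1 : ℝ) / 3) := Real.rpow_nonneg (Nat.cast_nonneg N) _
  exact mul_le_mul_of_nonneg_left (by exact_mod_cast hcard) (mul_nonneg hN0 (by positivity))

/-- **Class decomposition**: the prime pairs with `x³ + 2y³ ≡ r (mod d)` split along the classes
`(a, b) mod d` with `a³ + 2b³ ≡ r (mod d)`. [cite: HeathBrownMoroz2004, §3 (3.1)] -/
theorem card_primePairs_modEq_eq_sum_classes (X η : ℝ) {d : ℕ} (hd : 0 < d) (r : ℕ) :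
    #{xy ∈ primePairs X η | xy.1 ^ 3 + 2 * xy.2 ^ 3 ≡ r [MOD d]} =
      ∑ ab ∈ (range d ×ˢ range d).filter (fun ab : ℕ × ℕ => ab.1 ^ 3 + 2 * ab.2 ^ 3 ≡ r [MOD d]),
        #{xy ∈ primePairs X η | xy.1 ≡ ab.1 [MOD d] ∧ xy.2 ≡ ab.2 [MOD d]} := by
  rw [card_eq_sum_card_fiberwise (f := fun xy : ℕ × ℕ => (xy.1 % d, xy.2 % d))
    (t := (range d ×ˢ range d).filter (fun ab : ℕ × ℕ => ab.1 ^ 3 + 2 * ab.2 ^ 3 ≡ r [MOD d]))]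
  · refine sum_congr rfl fun ab hab => ?_
    obtain ⟨a, b⟩ := ab
    rw [mem_filter, mem_product, mem_range, mem_range] at hab
    obtain ⟨⟨ha, hb⟩, habr⟩ := hab
    congr 1
    ext ⟨x, y⟩
    simp only [mem_filter, Prod.mk.injEq, Nat.ModEq]
    constructor
    · rintro ⟨⟨hmem, -⟩, hx, hy⟩
      exact ⟨hmem, by rw [hx, Nat.mod_eq_of_lt ha], by rw [hy, Nat.mod_eq_of_lt hb]⟩
    · rintro ⟨hmem, hx, hy⟩
      rw [Nat.mod_eq_of_lt ha] at hx
      rw [Nat.mod_eq_of_lt hb] at hy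
      refine ⟨⟨hmem, ?_⟩, hx, hy⟩
      have h1 : x ^ 3 + 2 * y ^ 3 ≡ a ^ 3 + 2 * b ^ 3 [MOD d] := by
        have hx' : x ≡ a [MOD d] := by rw [Nat.ModEq, hx, Nat.mod_eq_of_lt ha]
        have hy' : y ≡ b [MOD d] := by rw [Nat.ModEq, hy, Nat.mod_eq_of_lt hb]
        exact (hx'.pow 3).add ((Nat.ModEq.refl 2).mul (hy'.pow 3))
      exact h1.trans habr
  · intro xy hxy
    obtain ⟨x, y⟩ := xy
    have hxy' := (mem_filter.mp (Finset.mem_coe.mp hxy))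
    simp only [Finset.coe_filter, Set.mem_setOf_eq, mem_product, mem_range]
    refine ⟨⟨Nat.mod_lt x hd, Nat.mod_lt y hd⟩, ?_⟩
    have h1 : (x % d) ^ 3 + 2 * (y % d) ^ 3 ≡ x ^ 3 + 2 * y ^ 3 [MOD d] :=
      ((Nat.mod_modEq x d).pow 3).add ((Nat.ModEq.refl 2).mul ((Nat.mod_modEq y d).pow 3))
    exact h1.trans hxy'.2

end Literature.NumberTheory.Sieve.CubicMinorant

end
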